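import Summits.FinalStateConjecture.FinalStateConjecture.Theses.PhaseMixingCapture
import Summits.FinalStateConjecture.FinalStateConjecture.Theses.CurvatureOrSymmetry
import Summits.FinalStateConjecture.FinalStateConjecture.Theses.TangentProfileCensorship
import Literature.Geometry.Lorentzian.TameGenericityLocal

/-!
# `WeakCosmicCensorshipTame` (stmt-FinalStateConjecture-17269, route PhaseMixingCapture, rank 5):
# the local-to-global and cross-route reductions of line `Sketch`

Helper file of the line lead (`--supports stmt-FinalStateConjecture-17269`; skeleton
`Cruxes/WeakCosmicCensorshipTame/Lines/Sketch.lean`). The crux is TAME weak cosmic censorship in MGHD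
form, `∀ X, IsTameChristodoulouGeneric (admissibleVacuumData X) ((∃ MGHD) ∧ ∀ MGHD, complete 𝓘⁺) 1`.
Everything here is sorry-free, definition-free pure logic over
`InitialDataSet.isTameChristodoulouGeneric_of_local` (members good for `0 < ‖c‖ < ε` suffice); the
hypotheses are existing route items BY NAME or their conjunct-deleted bodies written out verbatim:

* `weakCosmicCensorshipTame_of_censoredExit` — W from MGHD existence for all admissible data
  (`CurvatureOrSymmetry.MGHDExistence`, stmt-9937) and the CENSORED-ONLY tame exit at naked data
  (hypothesis body = `TangentProfileCensorship.NakedDataTameExit`, stmt-17383, with the Kerr-settling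
  conjuncts of the exit members deleted).
* `weakCosmicCensorshipTame_of_nakedDataTameExit` — hence W from the two items stmt-9937 ∧ stmt-17383
  by name (cross-route record: PhaseMixingCapture rank 5 ⇐ TangentProfileCensorship rank 2 + MGHD).
* `weakCosmicCensorshipTame_of_rayTrichotomy` — the composition of line `Sketch` in hypothetical
  form: MGHD existence (9937) + no fourth exit (10210) + no vacuum fountains (10211) + the censored-only
  exit at VISIBLE CURVATURE-BLOW-UP RAYS (hypothesis body = `CurvatureOrSymmetry.TameCurvatureModeExit`,
  stmt-17347, with the settling conjuncts deleted; = the registered stub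
  `stub_curvatureRayCensoredExit` of the line).
* `weakCosmicCensorshipTame_of_curvatureOrSymmetry` — hence W from the four CurvatureOrSymmetry items
  9937 ∧ 10210 ∧ 10211 ∧ 17347 by name (its rank-5 item `TameCensoredDataExit` is not needed for W).

Nothing here is analysis; the genericity content of W sits entirely in the exit hypotheses.
-/

-- the doubled `FinalStateConjecture.FinalStateConjecture` path component trips dupNamespace
set_option linter.dupNamespace false

noncomputable section

open scoped Manifold ContDiff Topology
open Set Function

namespace Summit.FinalStateConjecture.FinalStateConjecture.Theorems.PhaseMixingCaptureWeakCosmicCensorshipTame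

open Literature.Geometry.Lorentzian
open Summit.FinalStateConjecture.FinalStateConjecture.Theses
open Summit.FinalStateConjecture.FinalStateConjecture.Theses.PhaseMixingCapture (WeakCosmicCensorshipTame)

/-- **W from MGHD existence and a censored-only tame exit at naked data.** If every admissible datum
has an MGHD (`CurvatureOrSymmetry.MGHDExistence`), and through every admissible datum having an MGHD
with incomplete `𝓘⁺` passes a tame, immersed-at-`0`, injective admissible one-parameter family whose
members with `0 < ‖c‖ < ε` have an MGHD all of whose MGHDs have complete `𝓘⁺`, then
`WeakCosmicCensorshipTame`. The exit hypothesis is `TangentProfileCensorship.NakedDataTameExit`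
(stmt-17383) with the settling conjuncts deleted. Pure logic over
`InitialDataSet.isTameChristodoulouGeneric_of_local`. [folklore] -/
theorem weakCosmicCensorshipTame_of_censoredExit (hM : CurvatureOrSymmetry.MGHDExistence)
    (hE : ∀ (X : Type) [TopologicalSpace X] [ChartedSpace Literature.Geometry.Lorentzian.E3 X] [IsManifold (𝓡 3) ((⊤ : ℕ∞) : WithTop ℕ∞) X] [T2Space X] [SecondCountableTopology X] [ConnectedSpace X], ∀ D ∈ Literature.Geometry.Lorentzian.admissibleVacuumData X, (∃ 𝒟 : Literature.Geometry.Lorentzian.VacuumCauchyDevelopment D, 𝒟.IsMaximal ∧ ¬ Summit.FinalStateConjecture.HasCompleteNullInfinity 𝒟.toCauchyDevelopment) → ∃ (e : Literature.Geometry.Lorentzian.AFEnd X) (F : EuclideanSpace ℝ (Fin 1) → Literature.Geometry.Lorentzian.InitialDataSet (𝓡 3) X), Literature.Geometry.Lorentzian.InitialDataSet.IsTameDataFamily e 1 F ∧ Literature.Geometry.Lorentzian.InitialDataSet.IsImmersedAtZero 1 F ∧ F 0 = D ∧ Function.Injective F ∧ (∀ c, F c ∈ Literature.Geometry.Lorentzian.admissibleVacuumData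 X) ∧ ∃ ε : ℝ, 0 < ε ∧ ∀ c, c ≠ 0 → ‖c‖ < ε → ((∃ 𝒟 : Literature.Geometry.Lorentzian.VacuumCauchyDevelopment (F c), 𝒟.IsMaximal) ∧ ∀ 𝒟 : Literature.Geometry.Lorentzian.VacuumCauchyDevelopment (F c), 𝒟.IsMaximal → Summit.FinalStateConjecture.HasCompleteNullInfinity 𝒟.toCauchyDevelopment)) :
    WeakCosmicCensorshipTame := by
  intro X _ _ _ _ _ _
  refine InitialDataSet.isTameChristodoulouGeneric_of_local fun D hD hnot ↦ ?_
  have hex : ∃ 𝒟 : VacuumCauchyDevelopment D, 𝒟.IsMaximal := hM X D hD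
  have hbad : ∃ 𝒟 : VacuumCauchyDevelopment D, 𝒟.IsMaximal ∧
      ¬ Summit.FinalStateConjecture.HasCompleteNullInfinity 𝒟.toCauchyDevelopment := by
    by_contra h
    push Not at h
    exact hnot ⟨hex, h⟩
  obtain ⟨e, F, htame, himm, h0, hinj, hadm, ε, hε, hgood⟩ := hE X D hD hbad
  exact ⟨e, F, htame, himm, h0, hinj, hadm, ε, hε, fun c hc hcε ↦ hgood c hc hcε⟩

/-- **Cross-route record: W from stmt-9937 ∧ stmt-17383 by name.** MGHD existence for all admissible
data and the tame naked-data exit of route TangentProfileCensorship (whose exit members are good in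
the full re-typed sense) give `WeakCosmicCensorshipTame` (forget the settling conjuncts). [folklore] -/
theorem weakCosmicCensorshipTame_of_nakedDataTameExit (hM : CurvatureOrSymmetry.MGHDExistence)
    (hN : TangentProfileCensorship.NakedDataTameExit) : WeakCosmicCensorshipTame := by
  refine weakCosmicCensorshipTame_of_censoredExit hM fun X _ _ _ _ _ _ D hD hbad ↦ ?_
  obtain ⟨e, F, htame, himm, h0, hinj, hadm, ε, hε, hgood⟩ := hN X D hD hbad
  exact ⟨e, F, htame, himm, h0, hinj, hadm, ε, hε, fun c hc hcε ↦
    ⟨(hgood c hc hcε).1, fun 𝒟 h𝒟 ↦ ((hgood c hc hcε).2 𝒟 h𝒟).1⟩⟩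

/-- **The composition of line `Sketch`, hypothetical form (ray trichotomy).** MGHD existence
(stmt-9937) + NO FOURTH EXIT (stmt-10210: incomplete `𝓘⁺` of an MGHD is witnessed by a visible
future-incomplete null geodesic ending (a) in a parallelly-propagated curvature blow-up or (c) in a
local null Killing symmetry) + NO VACUUM FOUNTAINS (stmt-10211: (c) without (a) never happens) + the
censored-only tame exit at data carrying a visible curvature-blow-up ray (hypothesis body =
`CurvatureOrSymmetry.TameCurvatureModeExit`, stmt-17347, settling conjuncts deleted; the registered
stub `stub_curvatureRayCensoredExit` of the line) ⟹ `WeakCosmicCensorshipTame`. Classical case split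
on (a)/(c) under the `∀ [HasLeviCivita]` binder of the handle. [folklore] -/
theorem weakCosmicCensorshipTame_of_rayTrichotomy (hM : CurvatureOrSymmetry.MGHDExistence)
    (h4 : CurvatureOrSymmetry.NoFourthExit) (hF : CurvatureOrSymmetry.NoVacuumFountains)
    (hE : ∀ (X : Type) [TopologicalSpace X] [ChartedSpace Literature.Geometry.Lorentzian.E3 X] [IsManifold (𝓡 3) ((⊤ : ℕ∞) : WithTop ℕ∞) X] [T2Space X] [SecondCountableTopology X] [ConnectedSpace X], ∀ D ∈ Literature.Geometry.Lorentzian.admissibleVacuumData X, (∃ 𝒟 : Literature.Geometry.Lorentzian.VacuumCauchyDevelopment D, 𝒟.IsMaximal ∧ ¬ Summit.FinalStateConjecture.HasCompleteNullInfinity 𝒟.toCauchyDevelopment ∧ ∀ [𝒟.metric.HasLeviCivita], ∃ (γ : ℝ → 𝒟.carrier) (dom : Set ℝ), (Literature.Geometry.Lorentzian.IsMaximalGeodesicOn 𝒟.metric.leviCivita γ dom ∧ (0 : ℝ) ∈ dom ∧ BddAbove dom ∧ (∀ t ∈ dom, 𝒟.metric.IsNull (Literature.Geometry.Lorentzian.velocity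 (𝓡 4) γ t) ∧ 𝒟.timeOrientation.IsFutureDirected (Literature.Geometry.Lorentzian.velocity (𝓡 4) γ t)) ∧ (∀ t ∈ dom, 0 ≤ t → (∃ (p : X) (δ : ℝ → 𝒟.carrier) (s : Set ℝ), 𝒟.metric.IsNormalisedNullRayFrom 𝒟.timeOrientation 𝒟.embed 𝒟.normal p δ s ∧ ¬ BddAbove s ∧ γ t ∈ 𝒟.metric.chronologicalPast 𝒟.timeOrientation (δ '' (s ∩ Set.Ici 0))))) ∧ (∃ e : Fin 4 → (Π t : ℝ, TangentSpace (𝓡 4) (γ t)), (∀ a, ∀ t ∈ dom, MDifferentiableAt 𝓘(ℝ, ℝ) (𝓡 4).tangent (fun s : ℝ ↦ (Bundle.TotalSpace.mk' Literature.Geometry.Lorentzian.E4 (γ s) (e a s) : TangentBundle (𝓡 4) 𝒟.carrier)) t ∧ Literature.Geometry.Lorentzian.covariantDerivAlong 𝒟.metric.leviCivita γ (e a) t = 0) ∧ LinearIndependent ℝ (fun a ↦ e a 0) ∧ ∀ C : ℝ, ∃ t ∈ dom, 0 ≤ t ∧ ∃ a b c d : Fin 4, C < |𝒟.metric.val (γ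 t) (CovariantDerivative.curvature 𝒟.metric.leviCivita (γ t) (e a t) (e b t) (e c t)) (e d t)|)) → ∃ (e : Literature.Geometry.Lorentzian.AFEnd X) (F : EuclideanSpace ℝ (Fin 1) → Literature.Geometry.Lorentzian.InitialDataSet (𝓡 3) X), Literature.Geometry.Lorentzian.InitialDataSet.IsTameDataFamily e 1 F ∧ Literature.Geometry.Lorentzian.InitialDataSet.IsImmersedAtZero 1 F ∧ F 0 = D ∧ Function.Injective F ∧ (∀ c, F c ∈ Literature.Geometry.Lorentzian.admissibleVacuumData X) ∧ ∃ ε : ℝ, 0 < ε ∧ ∀ c, c ≠ 0 → ‖c‖ < ε → ((∃ 𝒟 : Literature.Geometry.Lorentzian.VacuumCauchyDevelopment (F c), 𝒟.IsMaximal) ∧ ∀ 𝒟 : Literature.Geometry.Lorentzian.VacuumCauchyDevelopment (F c), 𝒟.IsMaximal → Summit.FinalStateConjecture.HasCompleteNullInfinity 𝒟.toCauchyDevelopment)) :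
    WeakCosmicCensorshipTame := by
  refine weakCosmicCensorshipTame_of_censoredExit hM fun X _ _ _ _ _ _ D hD hbad ↦ ?_
  obtain ⟨𝒟, hmax, hnc⟩ := hbad
  exact hE X D hD ⟨𝒟, hmax, hnc, by
    intro inst
    obtain ⟨γ, dom, hstuff, hac⟩ := h4 X D hD 𝒟 hmax hnc
    rcases hac with ha | hc
    · exact ⟨γ, dom, hstuff, ha⟩
    · exact ⟨γ, dom, hstuff, Classical.byContradiction fun hna ↦
        hF X D hD 𝒟 hmax ⟨γ, dom, hstuff, hna, hc⟩⟩⟩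

/-- **Cross-route record: W from the CurvatureOrSymmetry items 9937 ∧ 10210 ∧ 10211 ∧ 17347 by
name.** The tame curvature-mode exit of route CurvatureOrSymmetry (members good in the full re-typed
sense) implies the censored-only exit at curvature rays a fortiori, so the ray trichotomy closes
`WeakCosmicCensorshipTame` from that route's cruxes of ranks 2, 3, 4, 9 (its rank-5 item
`TameCensoredDataExit` is not used). [folklore] -/
theorem weakCosmicCensorshipTame_of_curvatureOrSymmetry (hM : CurvatureOrSymmetry.MGHDExistence)
    (h4 : CurvatureOrSymmetry.NoFourthExit) (hF : CurvatureOrSymmetry.NoVacuumFountains)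
    (hT : CurvatureOrSymmetry.TameCurvatureModeExit) : WeakCosmicCensorshipTame := by
  refine weakCosmicCensorshipTame_of_rayTrichotomy hM h4 hF fun X _ _ _ _ _ _ D hD hhandle ↦ ?_
  obtain ⟨e, F, htame, himm, h0, hinj, hadm, ε, hε, hgood⟩ := hT X D hD hhandle
  exact ⟨e, F, htame, himm, h0, hinj, hadm, ε, hε, fun c hc hcε ↦
    ⟨(hgood c hc hcε).1, fun 𝒟 h𝒟 ↦ ((hgood c hc hcε).2 𝒟 h𝒟).1⟩⟩

end Summit.FinalStateConjecture.FinalStateConjecture.Theorems.PhaseMixingCaptureWeakCosmicCensorshipTame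

end
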